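import Literature.NumberTheory.EllipticCurves.FormalGroupLaurentPoints
import Literature.NumberTheory.EllipticCurves.FormalGroupShortModelParityProofs
import Literature.NumberTheory.EllipticCurves.FormalGroupLogSummableProofs
import Literature.NumberTheory.EllipticCurves.FormalLeafDenominatorsProofs
import Literature.NumberTheory.EllipticCurves.ManinConstantGoodPrimesProofs
import Literature.RingTheory.FormalGroups.HondaTypeTransport
import Literature.RingTheory.FormalGroups.DworkFrobeniusLift
import Summits.BirchSwinnertonDyer.Rank1Residual.ManinAdditive.CuspidalKummerClass
import HarnessLib

/-!
# The `2`-descent square on the formal group, `2`-integrality of `log`/`exp` for `a₁ = a₃ = 0`,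
# and the scaling of the short models `E_{W,c}` (formal-group half of E-an-47)

Summit `BirchSwinnertonDyer`, route `ManinLocalTwoThree` (cell bsd-f2-manin), deciding crux C2
`ManinOddAtFour` (stmt-BirchSwinnertonDyer-22967), reducible residual `Rb` of the line `kato_shift_two`
(lead p1).  The an planner's mechanism for `Rb` (MEMO-an §56; typed leaf
`…Rank1Residual.ManinAdditive.CuspidalKummerClass`, rows E-an-47/49⁺/52) reads the parity of the Manin
constant `c` through the cuspidal KUMMER CLASS of a rational 2-torsion point.  This file supplies the
formal-group half of the proof of E-an-47 `EvenManinKummerSquare` (sequel: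
`ManinLocalTwoThreeEvenManinKummerSquare`), all of it elementary and model-theoretic:

* §1 `formalXMulSq_formalMul_two_sub_root_mul_sq` — **the `2`-descent square on the formal group**:
  for a `p`-integral equation with `a₁ = a₃ = 0`, a root `e` of the cubic and `s ∈ Xℚ_p⟦X⟧`,
  `(X([2]s) − e·([2]s)²)·(2·s·X(s))² = ([2]s · ((X(s) − e s²)² − f′(e) s⁴))²` (`X = z²x(z)`), i.e.
  Silverman's `x(2Q) − e ≡ □` for the formal point, poles cleared — from the tree's formal
  duplication formula (`FormalGroupLaurentPoints.formalXMulSq_formalMul_two_subst`) and chart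
  equation (`formalXMulSq_subst_sq_eq`);
* §2 `isPadicInt_formalLog_of_a₁_a₃_two`, `isPadicInt_formalExp_of_a₁_a₃_two` — for a `2`-INTEGRAL
  model with `a₁ = a₃ = 0`, `log` and `exp` lie in `ℤ₂⟦T⟧` (the invariant differential is `2`-integral
  and EVEN, `FormalGroupShortModelParityProofs`, so only odd `n` divide; inverse of an integral series,
  `HondaTypeTransport.norm_coeff_substInvOfIsUnit_le_one`) — the replacement, at the ADDITIVE prime `2`,
  for Honda's strong isomorphism at good primes;
* §3 `eq_of_formalLog_subst_eq` (injectivity of `log` on `XA⟦X⟧`) and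
  `eq_formalMul_two_subst_formalExp_of_formalLog_subst` — **halving**: `log(D) = 2c′·L ⇒
  D = [2](exp(c′L))`;
* §4 `shortModel_eq_uScale_smul` (`E_{W,c} = (c⁻¹,0,0,0) • E_{W,1}`), `formalXMulSq_shortModel_subst`
  (`X_{E_{W,c}}(z) = X_{E_{W,1}}(cz)`), `formalLog_shortModel_subst` (`log_{E_{W,c}}(z) =
  c⁻¹ log_{E_{W,1}}(cz)`), `shortRoot_one_isRoot` (`e + b₂/12` is a root of `x³ − (c₄/48)x − c₆/864`).

No definitions; nothing about BSD or about any Manin constant is asserted here.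
-/

set_option autoImplicit false
set_option linter.dupNamespace false

noncomputable section

open scoped Classical
open PowerSeries WeierstrassCurve Literature.NumberTheory.EllipticCurves Literature.RingTheory.FormalGroups
open Summit.BirchSwinnertonDyer.Rank1Residual.ManinAdditive.CuspidalKummer

namespace Summit.BirchSwinnertonDyer.BirchSwinnertonDyer.Theorems.ManinLocalTwoThree

/-! ### §1 The `2`-descent square on the formal group (`a₁ = a₃ = 0`) -/

section FormalDoubling

variable {p : ℕ} [Fact p.Prime] (V : WeierstrassCurve ℤ_[p])
  [hE : (V.map PadicInt.Coe.ringHom).IsElliptic]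

/-- **The `2`-descent square on the formal group.** For a `p`-integral Weierstrass equation `V` with
`a₁ = a₃ = 0` (`y² = x³ + a₂x² + a₄x + a₆`) and elliptic generic fibre, a root `e ∈ ℚ_p` of the
cubic and a parameter `s ∈ Xℚ_p⟦X⟧`, put `D = [2](s)` and `X = z²x(z)` (`formalXMulSq`).  Then,
poles cleared, `(X(D) − e·D²)·(2·s·X(s))² = (D·((X(s) − e s²)² − f′(e) s⁴))²` with
`f′(e) = 3e² + 2a₂e + a₄` — the classical `x(2Q) − e = ((x_Q − e)² − f′(e))² / (2y_Q)²`
(Silverman AEC X.1: `P ↦ x(P) − e` is a homomorphism to `K^×/K^{×2}`) for the formal point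
`Q = (X(s)/s², −X(s)/s³)`; obtained from the tree's cleared duplication formula
`formalXMulSq_formalMul_two_subst` and chart equation `formalXMulSq_subst_sq_eq` by one polynomial
identity (using `f(e) = 0`). [cite: SilvermanAEC2009, X.1 Prop. 1.4 (shape: `x − e` modulo squares is a homomorphism)] -/
theorem formalXMulSq_formalMul_two_sub_root_mul_sq (h₁ : V.a₁ = 0) (h₃ : V.a₃ = 0) {e : ℚ_[p]}
    (he : e ^ 3 + (V.a₂ : ℚ_[p]) * e ^ 2 + (V.a₄ : ℚ_[p]) * e + (V.a₆ : ℚ_[p]) = 0)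
    {s : ℚ_[p]⟦X⟧} (hs : constantCoeff s = 0) :
    ((V.map PadicInt.Coe.ringHom).formalXMulSq.subst
          (((V.map PadicInt.Coe.ringHom).formalMul 2).subst s) -
        C e * ((V.map PadicInt.Coe.ringHom).formalMul 2).subst s ^ 2) *
      (2 * s * (V.map PadicInt.Coe.ringHom).formalXMulSq.subst s) ^ 2 =
    (((V.map PadicInt.Coe.ringHom).formalMul 2).subst s *
      (((V.map PadicInt.Coe.ringHom).formalXMulSq.subst s - C e * s ^ 2) ^ 2 -
        C (3 * e ^ 2 + 2 * (V.a₂ : ℚ_[p]) * e + (V.a₄ : ℚ_[p])) * s ^ 4)) ^ 2 := by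
  have hd := V.formalXMulSq_formalMul_two_subst PadicInt.Coe.ringHom hs
  have hch := (V.map PadicInt.Coe.ringHom).formalXMulSq_subst_sq_eq hs
  simp only [map_a₁, map_a₂, map_a₃, map_a₄, map_a₆, h₁, h₃, map_zero, zero_mul,
    add_zero, zero_sub] at hd hch
  have he' : (C e : ℚ_[p]⟦X⟧) ^ 3 + C (V.a₂ : ℚ_[p]) * C e ^ 2 + C (V.a₄ : ℚ_[p]) * C e +
      C (V.a₆ : ℚ_[p]) = 0 := by
    have := congrArg (C : ℚ_[p] →+* ℚ_[p]⟦X⟧) he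
    simpa only [map_add, map_mul, map_pow, map_zero] using this
  set Xs := (V.map PadicInt.Coe.ringHom).formalXMulSq.subst s
  set D := ((V.map PadicInt.Coe.ringHom).formalMul 2).subst s
  set XD := (V.map PadicInt.Coe.ringHom).formalXMulSq.subst D
  have hC : C (3 * e ^ 2 + 2 * (V.a₂ : ℚ_[p]) * e + (V.a₄ : ℚ_[p])) =
      3 * C e ^ 2 + 2 * C (V.a₂ : ℚ_[p]) * C e + C (V.a₄ : ℚ_[p]) := by
    simp only [map_add, map_mul, map_pow, map_ofNat]
  rw [hC]
  have hφ : ∀ x : ℤ_[p], PadicInt.Coe.ringHom x = (x : ℚ_[p]) := fun _ => rfl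
  simp only [hφ] at hd hch
  linear_combination hd + (-(4 : ℚ_[p]⟦X⟧) * D ^ 2 * (2 * Xs + (C (V.a₂ : ℚ_[p]) + C e) * s ^ 2)) * hch
    + (-(4 : ℚ_[p]⟦X⟧) * D ^ 2 * s ^ 6 * (2 * Xs + (C (V.a₂ : ℚ_[p]) + C e) * s ^ 2)) * he'

end FormalDoubling

/-! ### §2 `a₁ = a₃ = 0`, `2`-integral ⇒ `log`, `exp` are `2`-integral -/

section TwoIntegral

variable (V : WeierstrassCurve ℤ_[2])

/-- An odd integer is a `2`-adic unit: `‖(m : ℚ₂)⁻¹‖ = 1`. [folklore] -/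
theorem padicTwo_norm_inv_natCast_of_odd {m : ℕ}
    (hm : Odd m) : ‖((m : ℚ_[2]))⁻¹‖ = 1 := by
  have hle : ‖((m : ℤ) : ℚ_[2])‖ ≤ 1 := Padic.norm_int_le_one (m : ℤ)
  have hnlt : ¬ ‖((m : ℤ) : ℚ_[2])‖ < 1 := by
    rw [Padic.norm_intCast_lt_one_iff]
    intro h
    have : (2 : ℤ) ∣ (m : ℤ) := by exact_mod_cast h
    exact (Int.not_even_iff_odd.mpr (by exact_mod_cast hm)) (even_iff_two_dvd.mpr this)
  have h1 : ‖((m : ℤ) : ℚ_[2])‖ = 1 := le_antisymm hle (not_lt.mp hnlt)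
  rw [Int.cast_natCast] at h1
  rw [norm_inv, h1, inv_one]

/-- **`log_V ∈ ℤ₂⟦z⟧` for a `2`-integral model with `a₁ = a₃ = 0`.**  The invariant differential
`ω/dz` is `2`-integral (`isPadicInt_formalOmega`) and EVEN (`coeff_formalOmega_eq_zero_of_odd`:
`[-1](z) = −z` for `a₁ = a₃ = 0`), so `log_V = ∫ω = Σ_{n odd} (c_{n−1}/n) zⁿ` has only odd `n`
in the denominators — `2`-adic units. [cite: SilvermanAEC2009, IV.5.5 (shape: `log = ∫ω`); BlakestadGrant2023, Prop. 3 (no odd terms in `ω`)] -/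
theorem isPadicInt_formalLog_of_a₁_a₃_two (h₁ : V.a₁ = 0) (h₃ : V.a₃ = 0) :
    IsPadicInt (V.map PadicInt.Coe.ringHom).formalLog := by
  haveI := V.isIntegral_map_coe
  haveI : (V.map PadicInt.Coe.ringHom).IsCharNeTwoNF := ⟨by simp [h₁], by simp [h₃]⟩
  rw [isPadicInt_iff_coeff]
  intro n
  match n with
  | 0 => rw [coeff_zero_eq_constantCoeff, constantCoeff_formalLog, norm_zero]; exact zero_le_one
  | 1 => rw [coeff_one_formalLog, norm_one]
  | n + 2 =>
    have hc : coeff (n + 2) (V.map PadicInt.Coe.ringHom).formalLog =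
        algebraMap ℚ ℚ_[2] (1 / (n + 2 : ℚ)) * coeff (n + 1) (V.map PadicInt.Coe.ringHom).formalOmega := by
      rw [formalLog, coeff_mk]
    rw [hc]
    rcases Nat.even_or_odd (n + 1) with hev | hodd
    · -- `n + 1` even ⇒ `n + 2` odd: the denominator is a unit
      have hodd2 : Odd (n + 2) := by
        rw [show n + 2 = (n + 1) + 1 by ring]; exact hev.add_one
      have hω : ‖coeff (n + 1) (V.map PadicInt.Coe.ringHom).formalOmega‖ ≤ 1 :=
        isPadicInt_iff_coeff.mp (V.map PadicInt.Coe.ringHom).isPadicInt_formalOmega _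
      have hq : algebraMap ℚ ℚ_[2] (1 / (n + 2 : ℚ)) = (((n + 2 : ℕ) : ℚ_[2]))⁻¹ := by
        rw [one_div, map_inv₀]; push_cast; rfl
      rw [norm_mul, hq, padicTwo_norm_inv_natCast_of_odd hodd2, one_mul]
      exact hω
    · rw [(V.map PadicInt.Coe.ringHom).coeff_formalOmega_eq_zero_of_odd hodd, mul_zero, norm_zero]
      exact zero_le_one

/-- **`exp_V ∈ ℤ₂⟦z⟧` for a `2`-integral model with `a₁ = a₃ = 0`** (compositional inverse of an
integral series `z + ⋯`; `norm_coeff_substInvOfIsUnit_le_one`). So for such a model and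
`u ∈ Xℤ₂⟦X⟧` the parameter `exp_V(u)` is `2`-integral — the replacement, at the ADDITIVE prime `2`,
for Honda's strong isomorphism at good primes. [cite: SilvermanAEC2009, IV.5.5 (shape: `exp = log⁻¹`)] -/
theorem isPadicInt_formalExp_of_a₁_a₃_two (h₁ : V.a₁ = 0) (h₃ : V.a₃ = 0) :
    IsPadicInt (V.map PadicInt.Coe.ringHom).formalExp := by
  rw [isPadicInt_iff_coeff]
  intro n
  exact norm_coeff_substInvOfIsUnit_le_one (V.map PadicInt.Coe.ringHom).constantCoeff_formalLog
    (V.map PadicInt.Coe.ringHom).coeff_one_formalLog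
    (isPadicInt_iff_coeff.mp (isPadicInt_formalLog_of_a₁_a₃_two V h₁ h₃))
    (V.map PadicInt.Coe.ringHom).isUnit_coeff_one_formalLog n

end TwoIntegral

/-! ### §3 Injectivity of `log` and halving -/

section RatAlgebra

variable {A : Type*} [CommRing A] [Algebra ℚ A] (V : WeierstrassCurve A)

/-- `exp_V(log_V(t)) = t` for `t ∈ XA⟦X⟧`. [Silverman AEC IV.5.5] [folklore] -/
theorem formalExp_subst_formalLog_subst {t : A⟦X⟧} (ht : constantCoeff t = 0) :
    V.formalExp.subst (V.formalLog.subst t) = t := by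
  have hts : HasSubst t := HasSubst.of_constantCoeff_zero' ht
  rw [← subst_comp_subst_apply V.hasSubst_formalLog hts, V.formalExp_subst_formalLog, subst_X hts]

/-- `log_V(exp_V(t)) = t` for `t ∈ XA⟦X⟧`. [Silverman AEC IV.5.5] [folklore] -/
theorem formalLog_subst_formalExp_subst {t : A⟦X⟧} (ht : constantCoeff t = 0) :
    V.formalLog.subst (V.formalExp.subst t) = t := by
  have hts : HasSubst t := HasSubst.of_constantCoeff_zero' ht
  rw [← subst_comp_subst_apply V.hasSubst_formalExp hts, V.formalLog_subst_formalExp, subst_X hts]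

/-- **`log_V` is injective on `XA⟦X⟧`** (apply `exp_V`). [Silverman AEC IV.5.5] [folklore] -/
theorem eq_of_formalLog_subst_eq {t₁ t₂ : A⟦X⟧} (h₁ : constantCoeff t₁ = 0) (h₂ : constantCoeff t₂ = 0)
    (h : V.formalLog.subst t₁ = V.formalLog.subst t₂) : t₁ = t₂ := by
  rw [← formalExp_subst_formalLog_subst V h₁, h, formalExp_subst_formalLog_subst V h₂]

end RatAlgebra

section Padic

variable {p : ℕ} [Fact p.Prime] (W : WeierstrassCurve ℚ_[p]) [hW : W.IsIntegral ℤ_[p]]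

/-- **Halving in the formal group.** If `log_W(D) = c·L` with `c = 2c'`, then
`D = [2](exp_W(c'·L))` (both sides have formal logarithm `c·L`: `log[2] = 2 log`,
`log ∘ exp = id`). [Silverman AEC IV.5.2, IV.5.5] [folklore] -/
theorem eq_formalMul_two_subst_formalExp_of_formalLog_subst {D L : ℚ_[p]⟦X⟧}
    (hD : constantCoeff D = 0) (hL : constantCoeff L = 0) {c c' : ℚ_[p]} (hc : c = 2 * c')
    (hlog : W.formalLog.subst D = C c * L) :
    D = (W.formalMul 2).subst (W.formalExp.subst (C c' * L)) := by
  have hu0 : constantCoeff (C c' * L) = 0 := by rw [map_mul, hL, mul_zero]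
  have hus : HasSubst (C c' * L) := HasSubst.of_constantCoeff_zero' hu0
  set s := W.formalExp.subst (C c' * L) with hs
  have hs0 : constantCoeff s = 0 := by
    rw [hs, Literature.RingTheory.FormalGroups.constantCoeff_subst_of_constantCoeff_eq_zero hu0, W.constantCoeff_formalExp]
  have hss : HasSubst s := HasSubst.of_constantCoeff_zero' hs0
  have h20 : constantCoeff ((W.formalMul 2).subst s) = 0 := by
    rw [Literature.RingTheory.FormalGroups.constantCoeff_subst_of_constantCoeff_eq_zero hs0, W.constantCoeff_formalMul]
  refine eq_of_formalLog_subst_eq W hD h20 ?_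
  have key := congrArg (PowerSeries.subst s) (W.formalLog_subst_formalMul 2)
  rw [subst_comp_subst_apply (W.hasSubst_formalMul 2) hss, two_nsmul, subst_add hss, hs,
    formalLog_subst_formalExp_subst W hu0] at key
  rw [key, hlog, hc, map_mul, map_ofNat]
  ring

end Padic


/-! ### §4 Scaling of the short models -/

section Scale

variable {R : Type*} [CommRing R] (V : WeierstrassCurve R) (u : Rˣ)

/-- **`X_{S • V}(u z) = X_V(z)`** for the pure scaling `S = (u, 0, 0, 0)` (`x' = u⁻²x`,
`z' = uz`, so `z'²x' = z²x`), read through any `z ∈ XR⟦X⟧`. [Silverman AEC III.1, IV.1] [folklore] -/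
theorem formalXMulSq_uScale_smul_subst {z : R⟦X⟧} (hz : constantCoeff z = 0) :
    ((⟨u, 0, 0, 0⟩ : VariableChange R) • V).formalXMulSq.subst (C (u : R) * z) =
      V.formalXMulSq.subst z := by
  have hzs : HasSubst z := HasSubst.of_constantCoeff_zero' hz
  have hXs : HasSubst (C (u : R) * X : R⟦X⟧) := HasSubst.of_constantCoeff_zero' (by simp)
  have h := V.formalXMulSq_variableChange_subst_mul_X_sq ⟨u, 0, 0, 0⟩
  rw [formalVariableChange_uScale] at h
  have hu : (C (u : R) : R⟦X⟧) * C ((u⁻¹ : Rˣ) : R) = 1 := by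
    rw [← map_mul, Units.mul_inv, map_one]
  have h' : X ^ 2 * ((⟨u, 0, 0, 0⟩ : VariableChange R) • V).formalXMulSq.subst (C (u : R) * X) =
      X ^ 2 * V.formalXMulSq := by
    rw [mul_comm, h, map_zero, zero_mul, sub_zero]
    linear_combination (X ^ 2 * V.formalXMulSq * ((C (u : R) : R⟦X⟧) * C ((u⁻¹ : Rˣ) : R) + 1)) * hu
  have h'' := congrArg (PowerSeries.subst z) (X_pow_mul_cancel h')
  rw [subst_comp_subst_apply hXs hzs, subst_mul hzs, C_subst, subst_X hzs] at h''
  exact h''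

end Scale

section Short

variable (W : WeierstrassCurve ℚ) {c : ℤ} (hc : c ≠ 0)

include hc in
/-- **`E_{W,c} = (c⁻¹, 0, 0, 0) • E_{W,1}`**: the short model with Manin-constant scaling is the
pure rescaling `x ↦ c²x`, `y ↦ c³y` of the plain short model. [Silverman AEC III.1, Table 3.1] [folklore] -/
theorem shortModel_eq_uScale_smul :
    shortModel W c = ((⟨(Units.mk0 (c : ℚ) (Int.cast_ne_zero.mpr hc))⁻¹, 0, 0, 0⟩ :
      VariableChange ℚ) • shortModel W 1) := by
  ext <;> simp [shortModel, variableChange_a₁, variableChange_a₂, variableChange_a₃,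
    variableChange_a₄, variableChange_a₆] <;> ring

include hc in
/-- **`X_{E_{W,c}}(z) = X_{E_{W,1}}(c·z)`** for `z ∈ Xℚ⟦X⟧`. [folklore] -/
theorem formalXMulSq_shortModel_subst {z : ℚ⟦X⟧} (hz : constantCoeff z = 0) :
    (shortModel W c).formalXMulSq.subst z = (shortModel W 1).formalXMulSq.subst (C (c : ℚ) * z) := by
  have hcz : constantCoeff (C (c : ℚ) * z) = 0 := by rw [map_mul, hz, mul_zero]
  have h := formalXMulSq_uScale_smul_subst (shortModel W 1)
    (Units.mk0 (c : ℚ) (Int.cast_ne_zero.mpr hc))⁻¹ hcz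
  rw [← shortModel_eq_uScale_smul W hc, ← mul_assoc, ← map_mul, Units.val_inv_eq_inv_val,
    Units.val_mk0, inv_mul_cancel₀ (Int.cast_ne_zero.mpr hc), map_one, one_mul] at h
  exact h

include hc in
/-- **`log_{E_{W,c}}(z) = c⁻¹ · log_{E_{W,1}}(c·z)`** for `z ∈ Xℚ⟦X⟧` (`ω_{E_{W,c}} = c⁻¹ω`).
[cite: SilvermanAEC2009, IV.5.5] -/
theorem formalLog_shortModel_subst {z : ℚ⟦X⟧} (hz : constantCoeff z = 0) :
    (shortModel W c).formalLog.subst z =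
      C (c : ℚ)⁻¹ * (shortModel W 1).formalLog.subst (C (c : ℚ) * z) := by
  have hcz : constantCoeff (C (c : ℚ) * z) = 0 := by rw [map_mul, hz, mul_zero]
  have h := (shortModel W 1).formalLog_uScale_smul_subst
    (Units.mk0 (c : ℚ) (Int.cast_ne_zero.mpr hc))⁻¹ hcz
  rw [← shortModel_eq_uScale_smul W hc, ← mul_assoc, ← map_mul, Units.val_inv_eq_inv_val,
    Units.val_mk0, inv_mul_cancel₀ (Int.cast_ne_zero.mpr hc), map_one, one_mul] at h
  exact h

/-- **The 2-torsion abscissa on the short model.** If `e` is a root of the 2-division polynomial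
`4x³ + b₂x² + 2b₄x + b₆` of `W`, then `e + b₂/12` is a root of `x³ − (c₄/48)x − c₆/864`
(`x ↦ x + b₂/12` depresses the cubic; `c₄ = b₂² − 24b₄`, `c₆ = −b₂³ + 36b₂b₄ − 216b₆`).
[Silverman AEC III.1 (the `c₄, c₆` model)] [folklore] -/
theorem shortRoot_one_isRoot {e : ℚ} (he : W.twoTorsionPolynomial.toPoly.IsRoot e) :
    (shortRoot W 1 e) ^ 3 + (shortModel W 1).a₂ * (shortRoot W 1 e) ^ 2 +
      (shortModel W 1).a₄ * shortRoot W 1 e + (shortModel W 1).a₆ = 0 := by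
  have h : 4 * e ^ 3 + W.b₂ * e ^ 2 + 2 * W.b₄ * e + W.b₆ = 0 := by
    have := he
    rw [Polynomial.IsRoot, twoTorsionPolynomial, Cubic.toPoly] at this
    simp only [Polynomial.eval_add, Polynomial.eval_mul, Polynomial.eval_C, Polynomial.eval_pow,
      Polynomial.eval_X] at this
    linear_combination this
  simp only [shortRoot, shortModel, c₄, c₆, Int.cast_one, one_pow, one_mul]
  linear_combination (1 / 4 : ℚ) * h

end Short


end Summit.BirchSwinnertonDyer.BirchSwinnertonDyer.Theorems.ManinLocalTwoThree

end
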